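import Literature.Analysis.FluidPDE.TaoClassGlue
import Literature.Analysis.FluidPDE.CheskidovShvydkoyRegularProofs
import Literature.Analysis.FluidPDE.ConstantinSmallViscosity
import HarnessLib

/-!
# Constantin's comparison theorem: reduction to the a priori estimate (continuation by
# restart in Tao's smooth `H¹` class)

Analysis/FluidPDE proof file (theorems only; no definitions, no named facts) on the discharge
path of `Literature.Analysis.FluidPDE.constantin_small_viscosity` (`ConstantinSmallViscosity.lean`;
P. Constantin, *Note on loss of regularity for solutions of the 3-D incompressible Euler and
related equations*, Comm. Math. Phys. 104 (1986) 311–326, §1, Thm. 1.1, held text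
`paper:doi-10-1007-bf01211598` pp. 4–7).

Constantin's proof of Thm. 1.1 has two parts: (a) the **a priori estimate** (1.18) — as long as
the Navier–Stokes solution `u` (viscosity `ν ≤ ν₀`) from the Euler datum exists in `H^m` on
`[0, S] ⊆ [0, T]`, `‖u(t) − v(t)‖ₘ ≤ γₘ ν` with `γₘ, ν₀` depending only on the Euler solution `v`
on `[0, T]` (energy inequality (1.10) + ODE Lemma 1.3); (b) **continuation** (p. 7: "since the
validity of (1.18) depends upon `w(t)` belonging to `H^{m+2}` but not upon the size of
`|w(t)|_{m+2}` … one can argue by contradiction and infer that `|w(t)|_{m+2}` cannot become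
infinite for `t ≤ T`. We omit further details."), i.e. local existence with a lifespan controlled
by a norm that (a) keeps bounded, iterated up to `T`.

This file proves part (b) in the tree's setting, *assuming (a) as an explicit hypothesis*
(no named fact is introduced; the hypothesis is the printed a priori estimate, for solutions in
Tao's smooth `H¹` class `IsTaoSolutionOn`, in the `L²`-Sobolev form of the fact's conclusion):

* `exists_isTaoSolutionOn_of_apriori`: if every Tao-class solution `u` with viscosity
  `ν ∈ (0, ν₁]` from the datum `U 0` on a slab `[0, S] ⊆ [0, T]` satisfies
  `∫ ‖Dⁿ(u(t) − U(t))‖² ≤ (Cν)²` (`n ≤ m`, `m ≥ 1`), then for every such `ν` there IS a Tao-class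
  solution from `U 0` on the whole of `[0, T]`. The local theory used is Tao 2013, Thm. 5.4
  (ii)+(iv), **proved** in the tree (`tao2011_smooth_local_existence_holds`), whose lifespan
  `c ν³ ‖u(s)‖_{H¹}^{-4}` is controlled by the `H¹` norm; the a priori estimate at levels
  `n = 0, 1` and the Beale–Kato–Majda bounds of `U` give a uniform `H¹` bound `A` for all
  restart data `u(s)`, hence a uniform step `τ = min(1, cν³/(A+1)²)`; restarting at
  `t' = max(F/2, F − τ/4)` and gluing (`IsTaoSolutionOn.glue`, Prodi–Serrin uniqueness inside)
  advances the slab by `τ/2` until `T` is reached — the restart induction of the tree's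
  `exists_isTaoSolutionOn_of_hasGlobalKatoSolution` (`NSKatoToClayProofs`) with the a priori
  estimate in place of the Kato solution.
* `constantin_small_viscosity_of_apriori`: consequently the named fact follows from the a priori
  estimate (a) for all `m ≥ 3`, `T > 0` and all Euler solutions of the fact's class.

Part (a) is the subject of the companion files (`ConstantinDifferenceSlice`,
`ConstantinDifferenceEnergy`, `ConstantinODELemma`; also `ConstantinSmallViscosityCalculus`).

## Mathlib / tree search

Tree (used): `IsTaoSolutionOn.of_tao/slice/glue/mono` (`TaoClassGlue`),
`tao2011_smooth_local_existence_holds` (`CheskidovShvydkoyRegularProofs`),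
`ofReal_frobeniusNormSq_le_three_mul_enorm_sq` (`EnstrophyGronwall`). Mathlib:
`iteratedFDeriv_sub_apply`, `norm_iteratedFDeriv_zero`, `lintegral_add_left`, `exists_nat_gt`.
`lean search 'of_apriori'` in FluidPDE: `beale_kato_majda_of_localExistence_of_apriori`
(the same reduction pattern for BKM); nothing for Constantin's theorem.

## References

* P. Constantin, Comm. Math. Phys. 104 (1986) 311–326, §1, Thm. 1.1, (1.18)–(1.19) and the
  closing paragraph of §1 (held text p. 7). [Constantin1986]
* T. Tao, Anal. PDE 6 (2013) = arXiv:1108.1165, Thm. 5.4 (ii)+(iv). [Tao2011]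
-/

noncomputable section

open MeasureTheory Set Function Filter
open _root_.Topology
open scoped ENNReal NNReal ContDiff

namespace Literature.Analysis.FluidPDE

/-! ### Two `ℝ≥0∞` bookkeeping lemmas -/

section ENorm

variable {F : Type*} [NormedAddCommGroup F]

/-- `‖a‖² ≤ 2‖a − b‖² + 2‖b‖²` in `ℝ≥0∞`. [folklore] -/
theorem enorm_sq_le_two_mul_enorm_sub_sq_add (a b : F) :
    ‖a‖ₑ ^ 2 ≤ 2 * ‖a - b‖ₑ ^ 2 + 2 * ‖b‖ₑ ^ 2 := by
  have hreal : ‖a‖ ^ 2 ≤ 2 * ‖a - b‖ ^ 2 + 2 * ‖b‖ ^ 2 := by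
    have h1 : ‖a‖ ≤ ‖a - b‖ + ‖b‖ := norm_le_norm_sub_add a b
    nlinarith [norm_nonneg a, norm_nonneg (a - b), norm_nonneg b, sq_nonneg (‖a - b‖ - ‖b‖)]
  have e : ∀ c : F, ‖c‖ₑ ^ 2 = ENNReal.ofReal (‖c‖ ^ 2) := fun c => by
    rw [← ofReal_norm, ENNReal.ofReal_pow (norm_nonneg _)]
  rw [e, e, e, ← ENNReal.ofReal_ofNat 2, ← ENNReal.ofReal_mul (by norm_num),
    ← ENNReal.ofReal_mul (by norm_num), ← ENNReal.ofReal_add (by positivity) (by positivity)]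
  exact ENNReal.ofReal_le_ofReal hreal

/-- `∫‖a‖² ≤ 2∫‖a − b‖² + 2∫‖b‖²` (lower Lebesgue integrals; `a − b` continuous). [folklore] -/
theorem lintegral_enorm_sq_le_two_mul_sub_add {X : Type*} [TopologicalSpace X] [MeasurableSpace X]
    [OpensMeasurableSpace X] {μ : Measure X} {a b : X → F} (hab : Continuous fun x => a x - b x) :
    ∫⁻ x, ‖a x‖ₑ ^ 2 ∂μ ≤ 2 * ∫⁻ x, ‖a x - b x‖ₑ ^ 2 ∂μ + 2 * ∫⁻ x, ‖b x‖ₑ ^ 2 ∂μ := by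
  have hm : Measurable fun x => 2 * ‖a x - b x‖ₑ ^ 2 :=
    ((continuous_enorm.comp hab).measurable.pow_const 2).const_mul 2
  calc ∫⁻ x, ‖a x‖ₑ ^ 2 ∂μ ≤ ∫⁻ x, 2 * ‖a x - b x‖ₑ ^ 2 + 2 * ‖b x‖ₑ ^ 2 ∂μ :=
        lintegral_mono fun x => enorm_sq_le_two_mul_enorm_sub_sq_add _ _
    _ = 2 * ∫⁻ x, ‖a x - b x‖ₑ ^ 2 ∂μ + 2 * ∫⁻ x, ‖b x‖ₑ ^ 2 ∂μ := by
        rw [lintegral_add_left hm, lintegral_const_mul' _ _ ENNReal.ofNat_ne_top,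
          lintegral_const_mul' _ _ ENNReal.ofNat_ne_top]

end ENorm

/-! ### The restart induction -/

section Restart

/-- **Continuation from the a priori estimate (Constantin 1986, §1, closing paragraph; restart
in Tao's class).** Let `(U, P)` be a classical Euler solution on `[0, T] × ℝ³` in the
Beale–Kato–Majda class, `m ≥ 1`, `0 < ν ≤ ν₁`, and assume the a priori estimate: every Tao-class
Navier–Stokes solution `u` (viscosity `ν' ∈ (0, ν₁]`) from the datum `U 0` on a slab
`[0, S] ⊆ [0, T]` satisfies `∫ ‖Dⁿ(u(t) − U(t))‖² ≤ (Cν')²` for `t ∈ [0, S]`, `n ≤ m`. Then there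
is a Tao-class solution with viscosity `ν` from `U 0` on the whole slab `[0, T]` (Tao's local
existence theorem, proved in the tree, has lifespan `cν³‖u(s)‖⁻⁴_{H¹}`; the estimate at levels
`0, 1` bounds `‖u(s)‖_{H¹}` uniformly, so finitely many restarts and gluings reach `T`).
[cite: Constantin1986, §1 Thm. 1.1 (proof, (1.18)-(1.19))] -/
theorem exists_isTaoSolutionOn_of_apriori {m : ℕ} (hm : 1 ≤ m) {T : ℝ} (hT : 0 < T)
    {U : ℝ → EuclideanSpace ℝ (Fin 3) → EuclideanSpace ℝ (Fin 3)} {P : ℝ → EuclideanSpace ℝ (Fin 3) → ℝ}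
    (hE : IsClassicalEulerSolutionOn (Icc 0 T) 0 U P) (hB : HasBoundedSobolevNormsOn (Icc 0 T) U)
    {ν₁ C : ℝ}
    (hAP : ∀ ν' : ℝ, 0 < ν' → ν' ≤ ν₁ → ∀ S : ℝ, 0 < S → S ≤ T →
      ∀ (u : ℝ → EuclideanSpace ℝ (Fin 3) → EuclideanSpace ℝ (Fin 3)) (p : ℝ → EuclideanSpace ℝ (Fin 3) → ℝ), IsTaoSolutionOn S ν' (U 0) u p →
        ∀ t ∈ Icc 0 S, ∀ n ≤ m,
          ∫⁻ x, ‖iteratedFDeriv ℝ n (u t - U t) x‖ₑ ^ 2 ≤ ENNReal.ofReal (C * ν') ^ 2)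
    {ν : ℝ} (hν : 0 < ν) (hνν₁ : ν ≤ ν₁) :
    ∃ (u : ℝ → EuclideanSpace ℝ (Fin 3) → EuclideanSpace ℝ (Fin 3)) (p : ℝ → EuclideanSpace ℝ (Fin 3) → ℝ), IsTaoSolutionOn T ν (U 0) u p := by
  obtain ⟨c, hc, hloc⟩ := IsTaoSolutionOn.of_tao tao2011_smooth_local_existence_holds
  have h0T : (0 : ℝ) ∈ Icc 0 T := ⟨le_rfl, hT.le⟩
  -- the datum
  have ha : ContDiff ℝ ∞ (U 0) := hE.contDiff_velocity h0T
  have hadiv : VectorCalculus.IsDivFree (U 0) := hE.divFree 0 h0T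
  choose CU hCU using hB
  have hHa : ∀ n : ℕ, ∫⁻ x, ‖iteratedFDeriv ℝ n (U 0) x‖ₑ ^ 2 < ⊤ := fun n =>
    (hCU n 0 h0T).trans_lt ENNReal.coe_lt_top
  -- the Frobenius norm against `D¹`
  have hfrob_le3 : ∀ v : EuclideanSpace ℝ (Fin 3) → EuclideanSpace ℝ (Fin 3),
      ∫⁻ x, ENNReal.ofReal (frobeniusNormSq (fderiv ℝ v x)) ≤
        3 * ∫⁻ x, ‖iteratedFDeriv ℝ 1 v x‖ₑ ^ 2 := by
    intro v
    calc ∫⁻ x, ENNReal.ofReal (frobeniusNormSq (fderiv ℝ v x))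
        ≤ ∫⁻ x, 3 * ‖iteratedFDeriv ℝ 1 v x‖ₑ ^ 2 := lintegral_mono fun x => by
          rw [← ofReal_norm, norm_iteratedFDeriv_one, ofReal_norm]
          exact ofReal_frobeniusNormSq_le_three_mul_enorm_sq _
      _ = 3 * ∫⁻ x, ‖iteratedFDeriv ℝ 1 v x‖ₑ ^ 2 := lintegral_const_mul' _ _ (by simp)
  -- the uniform bound for the `H¹` quantity of Tao-class solutions from `U 0` on `[0, F] ⊆ [0, T]`
  set D : ℝ≥0∞ := ENNReal.ofReal (|C| * ν₁) ^ 2 with hD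
  have hDtop : D ≠ ⊤ := ENNReal.pow_ne_top ENNReal.ofReal_ne_top
  set Aq : ℝ≥0∞ := (2 * D + 2 * (CU 0 : ℝ≥0∞)) + 3 * (2 * D + 2 * (CU 1 : ℝ≥0∞)) with hAq
  have hAqtop : Aq ≠ ⊤ := by
    rw [hAq]
    refine ENNReal.add_ne_top.2 ⟨ENNReal.add_ne_top.2 ⟨ENNReal.mul_ne_top (by simp) hDtop,
      ENNReal.mul_ne_top (by simp) ENNReal.coe_ne_top⟩, ENNReal.mul_ne_top (by simp)
      (ENNReal.add_ne_top.2 ⟨ENNReal.mul_ne_top (by simp) hDtop,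
        ENNReal.mul_ne_top (by simp) ENNReal.coe_ne_top⟩)⟩
  set A : ℝ := Aq.toReal with hA
  have hA0 : 0 ≤ A := ENNReal.toReal_nonneg
  have hA1 : 0 ≤ A + 1 := by positivity
  have hAqA : Aq ≤ ENNReal.ofReal (A + 1) := by
    rw [hA, ENNReal.ofReal_add ENNReal.toReal_nonneg zero_le_one, ENNReal.ofReal_toReal hAqtop]
    exact le_self_add
  have hCν' : C * ν ≤ |C| * ν₁ :=
    (mul_le_mul_of_nonneg_right (le_abs_self C) hν.le).trans
      (mul_le_mul_of_nonneg_left hνν₁ (abs_nonneg C))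
  have hCν : ENNReal.ofReal (C * ν) ^ 2 ≤ D := by
    rw [hD]
    exact pow_le_pow_left' (ENNReal.ofReal_le_ofReal hCν') 2
  have hkey : ∀ ⦃F : ℝ⦄ ⦃u : ℝ → EuclideanSpace ℝ (Fin 3) → EuclideanSpace ℝ (Fin 3)⦄ ⦃p : ℝ → EuclideanSpace ℝ (Fin 3) → ℝ⦄, 0 < F → F ≤ T →
      IsTaoSolutionOn F ν (U 0) u p → ∀ t ∈ Icc 0 F,
        (∫⁻ x, ‖u t x‖ₑ ^ 2) + (∫⁻ x, ENNReal.ofReal (frobeniusNormSq (fderiv ℝ (u t) x))) ≤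
          ENNReal.ofReal (A + 1) := by
    intro F u p hF hFT h t ht
    have htT : t ∈ Icc 0 T := ⟨ht.1, ht.2.trans hFT⟩
    have hu : ContDiff ℝ ∞ (u t) := (h.slice ht).1
    have hUt : ContDiff ℝ ∞ (U t) := hE.contDiff_velocity htT
    have hw : ContDiff ℝ ∞ (u t - U t) := hu.sub hUt
    have h0 := hAP ν hν hνν₁ F hF hFT u p h t ht 0 (by omega)
    have h1 := hAP ν hν hνν₁ F hF hFT u p h t ht 1 hm
    -- level `0`
    have hL0 : ∫⁻ x, ‖u t x‖ₑ ^ 2 ≤ 2 * D + 2 * (CU 0 : ℝ≥0∞) := by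
      have hcont : Continuous fun x => u t x - U t x := hu.continuous.sub hUt.continuous
      have e1 : ∫⁻ x, ‖u t x - U t x‖ₑ ^ 2 = ∫⁻ x, ‖iteratedFDeriv ℝ 0 (u t - U t) x‖ₑ ^ 2 :=
        lintegral_congr fun x => by
          rw [← ofReal_norm, ← ofReal_norm, norm_iteratedFDeriv_zero]; rfl
      have e2 : ∫⁻ x, ‖U t x‖ₑ ^ 2 = ∫⁻ x, ‖iteratedFDeriv ℝ 0 (U t) x‖ₑ ^ 2 :=
        lintegral_congr fun x => by rw [← ofReal_norm, ← ofReal_norm, norm_iteratedFDeriv_zero]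
      calc ∫⁻ x, ‖u t x‖ₑ ^ 2 ≤ 2 * (∫⁻ x, ‖u t x - U t x‖ₑ ^ 2) + 2 * ∫⁻ x, ‖U t x‖ₑ ^ 2 :=
            lintegral_enorm_sq_le_two_mul_sub_add hcont
        _ ≤ 2 * D + 2 * (CU 0 : ℝ≥0∞) := by
            rw [e1, e2]
            gcongr
            · exact h0.trans hCν
            · exact hCU 0 t htT
    -- level `1`
    have hL1 : ∫⁻ x, ‖iteratedFDeriv ℝ 1 (u t) x‖ₑ ^ 2 ≤ 2 * D + 2 * (CU 1 : ℝ≥0∞) := by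
      have hu1 : ContDiff ℝ 1 (u t) := hu.of_le (by norm_cast)
      have hU1 : ContDiff ℝ 1 (U t) := hUt.of_le (by norm_cast)
      have hw1 : ContDiff ℝ 1 (u t - U t) := hu1.sub hU1
      have hsub : ∀ x, iteratedFDeriv ℝ 1 (u t) x - iteratedFDeriv ℝ 1 (U t) x =
          iteratedFDeriv ℝ 1 (u t - U t) x := fun x =>
        (iteratedFDeriv_sub_apply hu1.contDiffAt hU1.contDiffAt).symm
      have hcont : Continuous fun x => iteratedFDeriv ℝ 1 (u t) x - iteratedFDeriv ℝ 1 (U t) x := by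
        simp_rw [hsub]
        exact hw1.continuous_iteratedFDeriv le_rfl
      have e1 : ∫⁻ x, ‖iteratedFDeriv ℝ 1 (u t) x - iteratedFDeriv ℝ 1 (U t) x‖ₑ ^ 2 =
          ∫⁻ x, ‖iteratedFDeriv ℝ 1 (u t - U t) x‖ₑ ^ 2 :=
        lintegral_congr fun x => by rw [hsub x]
      calc ∫⁻ x, ‖iteratedFDeriv ℝ 1 (u t) x‖ₑ ^ 2
          ≤ 2 * (∫⁻ x, ‖iteratedFDeriv ℝ 1 (u t) x - iteratedFDeriv ℝ 1 (U t) x‖ₑ ^ 2) +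
              2 * ∫⁻ x, ‖iteratedFDeriv ℝ 1 (U t) x‖ₑ ^ 2 :=
            lintegral_enorm_sq_le_two_mul_sub_add hcont
        _ ≤ 2 * D + 2 * (CU 1 : ℝ≥0∞) := by
            rw [e1]
            gcongr
            · exact h1.trans hCν
            · exact hCU 1 t htT
    calc (∫⁻ x, ‖u t x‖ₑ ^ 2) + (∫⁻ x, ENNReal.ofReal (frobeniusNormSq (fderiv ℝ (u t) x)))
        ≤ (2 * D + 2 * (CU 0 : ℝ≥0∞)) + 3 * ∫⁻ x, ‖iteratedFDeriv ℝ 1 (u t) x‖ₑ ^ 2 :=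
          add_le_add hL0 (hfrob_le3 (u t))
      _ ≤ (2 * D + 2 * (CU 0 : ℝ≥0∞)) + 3 * (2 * D + 2 * (CU 1 : ℝ≥0∞)) := by gcongr
      _ = Aq := by rw [hAq]
      _ ≤ ENNReal.ofReal (A + 1) := hAqA
  -- the uniform step
  set τ : ℝ := min 1 (c * ν ^ 3 / (A + 1) ^ 2) with hτ
  have hτpos : 0 < τ := lt_min one_pos (by positivity)
  have hτc : (A + 1) ^ 2 * τ ≤ c * ν ^ 3 := by
    calc (A + 1) ^ 2 * τ ≤ (A + 1) ^ 2 * (c * ν ^ 3 / (A + 1) ^ 2) :=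
          mul_le_mul_of_nonneg_left (min_le_right _ _) (sq_nonneg _)
      _ = c * ν ^ 3 := by field_simp
  /- the restart step: from `[0, F]`, `F < T`, to `[0, min (t' + τ) T] ⊇ [0, min (F + τ/2) T]` -/
  have hstep : ∀ ⦃F : ℝ⦄ ⦃u : ℝ → EuclideanSpace ℝ (Fin 3) → EuclideanSpace ℝ (Fin 3)⦄ ⦃p : ℝ → EuclideanSpace ℝ (Fin 3) → ℝ⦄, 0 < F → F < T →
      IsTaoSolutionOn F ν (U 0) u p →
      ∃ (F' : ℝ) (u' : ℝ → EuclideanSpace ℝ (Fin 3) → EuclideanSpace ℝ (Fin 3)) (p' : ℝ → EuclideanSpace ℝ (Fin 3) → ℝ),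
        (T ≤ F' ∨ F + τ / 2 ≤ F') ∧ F' ≤ T ∧ 0 < F' ∧ IsTaoSolutionOn F' ν (U 0) u' p' := by
    intro F u p hF hFT h
    set t' : ℝ := max (F / 2) (F - τ / 4) with ht'
    have ht'0 : 0 ≤ t' := le_max_of_le_left (by linarith)
    have ht'F : t' < F := max_lt (by linarith) (by linarith)
    have hFt' : F ≤ t' + τ := by linarith [le_max_right (F / 2) (F - τ / 4)]
    have ht'I : t' ∈ Icc 0 F := ⟨ht'0, ht'F.le⟩
    obtain ⟨hsm', hdiv', hH'⟩ := h.slice ht'I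
    have hbound := hkey hF hFT.le h t' ht'I
    obtain ⟨v, q, hv⟩ := hloc hν hτpos hsm' hdiv' hH' hA1 hbound hτc
    have hglue := h.glue hv hν hτpos ht'0 ht'F hFt'
    set F' : ℝ := min (t' + τ) T with hF'
    have hF'pos : 0 < F' := lt_min (by linarith) hT
    have hF'le : F' ≤ t' + τ := min_le_left _ _
    refine ⟨F', _, _, ?_, min_le_right _ _, hF'pos, hglue.mono hF'pos hF'le⟩
    by_cases hcase : T ≤ t' + τ
    · left; rw [hF', min_eq_right hcase]
    · right
      rw [hF', min_eq_left (le_of_not_ge hcase)]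
      linarith [le_max_right (F / 2) (F - τ / 4)]
  /- the first patch, from the datum, on `[0, T₀]` with `T₀ ≤ T` -/
  have hbase : ∃ (F : ℝ) (u : ℝ → EuclideanSpace ℝ (Fin 3) → EuclideanSpace ℝ (Fin 3)) (p : ℝ → EuclideanSpace ℝ (Fin 3) → ℝ),
      IsTaoSolutionOn F ν (U 0) u p ∧ 0 < F ∧ F ≤ T := by
    have hdat0 : ∫⁻ x, ‖U 0 x‖ₑ ^ 2 < ⊤ := by
      refine lt_of_le_of_lt (le_of_eq (lintegral_congr fun x => ?_)) (hHa 0)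
      rw [← ofReal_norm, ← ofReal_norm, norm_iteratedFDeriv_zero]
    have hG₀ : ∫⁻ x, ENNReal.ofReal (frobeniusNormSq (fderiv ℝ (U 0) x)) < ⊤ :=
      (hfrob_le3 (U 0)).trans_lt (ENNReal.mul_lt_top (by simp) (hHa 1))
    set A₀ : ℝ := ((∫⁻ x, ‖U 0 x‖ₑ ^ 2) +
      ∫⁻ x, ENNReal.ofReal (frobeniusNormSq (fderiv ℝ (U 0) x))).toReal with hA₀
    have hA₀0 : 0 ≤ A₀ := ENNReal.toReal_nonneg
    have hA₀eq : (∫⁻ x, ‖U 0 x‖ₑ ^ 2) + ∫⁻ x, ENNReal.ofReal (frobeniusNormSq (fderiv ℝ (U 0) x))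
        ≤ ENNReal.ofReal A₀ := by
      rw [hA₀, ENNReal.ofReal_toReal (ENNReal.add_ne_top.2 ⟨hdat0.ne, hG₀.ne⟩)]
    set T₀ : ℝ := min T (c * ν ^ 3 / (A₀ ^ 2 + 1)) with hT₀
    have hT₀pos : 0 < T₀ := lt_min hT (by positivity)
    have hT₀c : A₀ ^ 2 * T₀ ≤ c * ν ^ 3 := by
      calc A₀ ^ 2 * T₀ ≤ A₀ ^ 2 * (c * ν ^ 3 / (A₀ ^ 2 + 1)) :=
            mul_le_mul_of_nonneg_left (min_le_right _ _) (sq_nonneg _)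
        _ = c * ν ^ 3 * (A₀ ^ 2 / (A₀ ^ 2 + 1)) := by ring
        _ ≤ c * ν ^ 3 * 1 :=
            mul_le_mul_of_nonneg_left (by rw [div_le_one (by positivity)]; linarith) (by positivity)
        _ = c * ν ^ 3 := mul_one _
    obtain ⟨u, p, h⟩ := hloc hν hT₀pos ha hadiv hHa hA₀0 hA₀eq hT₀c
    exact ⟨T₀, u, p, h, hT₀pos, min_le_left _ _⟩
  /- the induction -/
  have hiter : ∀ k : ℕ, ∃ (F : ℝ) (u : ℝ → EuclideanSpace ℝ (Fin 3) → EuclideanSpace ℝ (Fin 3)) (p : ℝ → EuclideanSpace ℝ (Fin 3) → ℝ),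
      IsTaoSolutionOn F ν (U 0) u p ∧ 0 < F ∧ F ≤ T ∧ (T ≤ F ∨ (k : ℝ) * (τ / 2) ≤ F) := by
    intro k
    induction k with
    | zero =>
      obtain ⟨F, u, p, h, hF, hFT⟩ := hbase
      exact ⟨F, u, p, h, hF, hFT, Or.inr (by simpa using hF.le)⟩
    | succ k ih =>
      obtain ⟨F, u, p, h, hF, hFT, halt⟩ := ih
      rcases le_or_gt T F with hdone | hlt
      · exact ⟨F, u, p, h, hF, hFT, Or.inl hdone⟩
      · obtain ⟨F', u', p', hprog, hF'T, hF'pos, h'⟩ := hstep hF hlt h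
        refine ⟨F', u', p', h', hF'pos, hF'T, ?_⟩
        rcases hprog with hd | hadv
        · exact Or.inl hd
        · rcases halt with hd | hk
          · exact absurd hd (not_le.2 hlt)
          · right
            push_cast
            linarith
  obtain ⟨k, hk⟩ := exists_nat_gt (T / (τ / 2))
  obtain ⟨F, u, p, h, hF, hFT, halt⟩ := hiter k
  have hTF : T ≤ F := by
    rcases halt with hd | hk'
    · exact hd
    · have h2 : T < (k : ℝ) * (τ / 2) := by rwa [div_lt_iff₀ (by positivity)] at hk
      linarith
  have hFeq : F = T := le_antisymm hFT hTF
  rw [hFeq] at h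
  exact ⟨u, p, h⟩

/-- **Constantin 1986, Thm. 1.1, from its a priori estimate.** If for every `m ≥ 3`, `T > 0`
and every classical Euler solution `(U, P)` on `[0, T] × ℝ³` in the Beale–Kato–Majda class with
rapidly decaying datum there are `ν₁ > 0` and `C` such that all Tao-class Navier–Stokes solutions
`u` (viscosity `ν ∈ (0, ν₁]`) from `U 0` on slabs `[0, S] ⊆ [0, T]` satisfy the a priori
estimate `∫ ‖Dⁿ(u(t) − U(t))‖² ≤ (Cν)²`, `n ≤ m` (Constantin's (1.18)), then
`constantin_small_viscosity` holds: for `0 < ν ≤ ν₁` the restart induction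
`exists_isTaoSolutionOn_of_apriori` produces a classical solution on `[0, T]` in the BKM class
with the datum `U 0`, and the estimate on `[0, T]` is the closeness clause.
[cite: Constantin1986, §1 Thm. 1.1] -/
theorem constantin_small_viscosity_of_apriori
    (hAP : ∀ m : ℕ, 3 ≤ m → ∀ T : ℝ, 0 < T → ∀ (U : ℝ → EuclideanSpace ℝ (Fin 3) → EuclideanSpace ℝ (Fin 3)) (P : ℝ → EuclideanSpace ℝ (Fin 3) → ℝ),
      IsClassicalEulerSolutionOn (Icc 0 T) 0 U P → HasBoundedSobolevNormsOn (Icc 0 T) U →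
        HasRapidSpatialDecay (U 0) →
          ∃ ν₁ : ℝ, 0 < ν₁ ∧ ∃ C : ℝ, ∀ ν : ℝ, 0 < ν → ν ≤ ν₁ → ∀ S : ℝ, 0 < S → S ≤ T →
            ∀ (u : ℝ → EuclideanSpace ℝ (Fin 3) → EuclideanSpace ℝ (Fin 3)) (p : ℝ → EuclideanSpace ℝ (Fin 3) → ℝ), IsTaoSolutionOn S ν (U 0) u p →
              ∀ t ∈ Icc 0 S, ∀ n ≤ m,
                ∫⁻ x, ‖iteratedFDeriv ℝ n (u t - U t) x‖ₑ ^ 2 ≤ ENNReal.ofReal (C * ν) ^ 2) :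
    constantin_small_viscosity := by
  intro m hm T hT U P hE hB hd
  obtain ⟨ν₁, hν₁, C, hC⟩ := hAP m hm T hT U P hE hB hd
  refine ⟨ν₁, hν₁, C, fun ν hν hνν₁ => ?_⟩
  obtain ⟨u, p, h⟩ := exists_isTaoSolutionOn_of_apriori (m := m) (by omega) hT hE hB hC hν hνν₁
  exact ⟨u, p, h.classical, h.sobolev, h.initial, fun t ht n hn =>
    hC ν hν hνν₁ T hT le_rfl u p h t ht n hn⟩

end Restart

end Literature.Analysis.FluidPDE

end
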